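import Summits.BirchSwinnertonDyer.BirchSwinnertonDyer.Theorems.KimAtThreeDeepUpperExpStarFacts
import Summits.BirchSwinnertonDyer.BirchSwinnertonDyer.Theorems.KimAtThreeDeepLowerExpStarOmegaRes
import Literature.NumberTheory.PAdicHodge.DualExpEllipticTower
import HarnessLib

/-!
# Bridge between hLog₀'s class-level `exp*` currency and the tower cite-fact currency
# (cell `bsd-addord`, seat w2-acc4 gen 5 = owner of `hLog₀` of crux 19560; helper)

HONEST FRAMING.  hLog₀ (kim3 p508902) speaks of `expStarOmegaHom hL ((galRestrictPlace v).comp (absGaloisRestrict ℚ_v L)) dw`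
on CLASSES of the representation `localTateRep W p ((galRestrictPlace v).comp _)` and states (RES_w) at class level
with `ContinuousRep.cohomologyRes`; the cite fact (S5b-tower) (w2-c3 p511026) and w2-acc4's `dualInt_of_towerFact`
speak of `expStarCoordTower W hL dw η` on COCYCLES of the tower representation
`(restrictedRationalTateRep W ℚ_v p).restrict (absGaloisRestrict ℚ_v L)` and state (RES) at cocycle level.  The two
representations are definitionally equal (`localRationalTateRep_comp`, `localTateRep_comp`, both `rfl`), so the
bridge is bookkeeping; it is isolated here because elaborating a line datum across the two spellings inside a large
statement is expensive (w2-acc4 STATUS 2026-08-27T08:46Z).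

* `expStarOmegaHom_oneCocycleClass_eq_expStarCoordTower` — `exp*_{dw} [η] = expStarCoordTower dw η`;
* `compat_of_res` — class-level (RES_w) ⇒ the cocycle-level compatibility hypothesis of (S5b-tower).

TOOL theorems only; closes nothing; BSD / 19560 not proved by any of this.  References: K. Kato, LNM 1553 (1993)
Ch. II §1.2.4 [Kato1993LNM1553]; J.-P. Serre, *Galois Cohomology* (1997) I §2.4 [SerreGaloisCohomology1997].
-/

noncomputable section

-- the cell's Theorems namespace `Summit.BirchSwinnertonDyer.BirchSwinnertonDyer.…` repeats the summit name by design (D-0017)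
set_option linter.dupNamespace false

open scoped TensorProduct NumberField NNReal Classical
open Field ValuativeRel Function IsDedekindDomain NumberField
open Literature.NumberTheory.GaloisRepresentations
open Literature.NumberTheory.GaloisRepresentations.PeriodRingData
open Literature.NumberTheory.GaloisRepresentations.IsNonarchimedeanLocalField
open Literature.NumberTheory.GaloisCohomology
open Literature.NumberTheory.PAdicHodge
open Literature.NumberTheory.EllipticCurves WeierstrassCurve
open Summit.BirchSwinnertonDyer.BirchSwinnertonDyer.Theorems.KimAtThreeDeepLowerExpStarOmega
open Summit.BirchSwinnertonDyer.BirchSwinnertonDyer.Theorems.KimAtThreeDeepLowerExpStarOmegaPlace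
open Summit.BirchSwinnertonDyer.BirchSwinnertonDyer.Theorems.KimAtThreeDeepLowerExpStarOmegaRes
open Summit.BirchSwinnertonDyer.BirchSwinnertonDyer.Theorems.KimAtThreeDeepUpperExpStarFacts
open Summit.BirchSwinnertonDyer.Rank1Residual.GaloisImage

namespace Summit.BirchSwinnertonDyer.BirchSwinnertonDyer.Theorems.KimAtThreeFineKatoHLog

variable (W : WeierstrassCurve ℚ) [W.IsElliptic] (p : ℕ) [Fact p.Prime]
  (v : HeightOneSpectrum (𝓞 ℚ)) [hv : Fact (((p : ℕ) : 𝓞 ℚ) ∈ v.asIdeal)]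

attribute [local instance 100000] NumberField.Place.instAlgebraCompletion
attribute [local instance] valuativeRelPlace topologicalSpacePlace
attribute [local instance] isNonarchimedeanLocalField_place charZero_place
attribute [local instance] padicAlgebraPlace fact_not_isUnit_place isAdicComplete_place

variable {L : Type} [Field L] [ValuativeRel L] [TopologicalSpace L] [IsNonarchimedeanLocalField L]
  [CharZero L] [Algebra (Place.Completion (Sum.inr v : Place ℚ)) L]
  [Fact (¬ IsUnit (p : integerC L))] [IsAdicComplete (Ideal.span {(p : integerC L)}) (integerC L)]
  (hL : valuation L p < 1) [Algebra ℚ_[p] L]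

omit hv in
/-- The cell's tower line data ARE the cite-fact's tower line data (the representations agree definitionally,
`localRationalTateRep_comp`). -/
theorem localNeronLine_comp_eq :
    LocalNeronLine W hL ((galRestrictPlace v).comp (absGaloisRestrict (Place.Completion (Sum.inr v : Place ℚ)) L)) =
      (bdRPeriodRingData hL).FilZeroLine
        ((restrictedRationalTateRep W (Place.Completion (Sum.inr v : Place ℚ)) p).restrict
          (absGaloisRestrict (Place.Completion (Sum.inr v : Place ℚ)) L)) := rfl

omit hv in
/-- **`exp*_{dw} [η] = expStarCoordTower dw η`**: hLog₀'s class-level `expStarOmegaHom` on the class of a cocycle is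
the cite-fact currency `expStarCoordTower` (both are Kato's `dualExpCoord` of `σ ↦ 1 ⊗ η σ`).
[cite: Kato1993LNM1553, Ch. II §1.2.4] -/
theorem expStarOmegaHom_oneCocycleClass_eq_expStarCoordTower
    (dw : LocalNeronLine W hL ((galRestrictPlace v).comp (absGaloisRestrict (Place.Completion (Sum.inr v : Place ℚ)) L)))
    (hinjw : (bdRPeriodRingData hL).CupLogInjective (logCyclotomic p)
      (localRationalTateRep W p ((galRestrictPlace v).comp (absGaloisRestrict (Place.Completion (Sum.inr v : Place ℚ)) L))))
    (hexw : ∀ z : contOneCocycles (localRationalTateRep W p ((galRestrictPlace v).comp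
        (absGaloisRestrict (Place.Completion (Sum.inr v : Place ℚ)) L))).toTopRep,
      (bdRPeriodRingData hL).HasDualExp (logCyclotomic p)
        (localRationalTateRep W p ((galRestrictPlace v).comp
          (absGaloisRestrict (Place.Completion (Sum.inr v : Place ℚ)) L))) fun σ => z.1 σ)
    (η : contOneCocycles (localTateRep W p ((galRestrictPlace v).comp
      (absGaloisRestrict (Place.Completion (Sum.inr v : Place ℚ)) L))).toTopRep) :
    expStarOmegaHom hL ((galRestrictPlace v).comp (absGaloisRestrict (Place.Completion (Sum.inr v : Place ℚ)) L))
        dw hinjw hexw (oneCocycleClass _ η) =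
      expStarCoordTower W hL (show (bdRPeriodRingData hL).FilZeroLine
        ((restrictedRationalTateRep W (Place.Completion (Sum.inr v : Place ℚ)) p).restrict
          (absGaloisRestrict (Place.Completion (Sum.inr v : Place ℚ)) L)) from dw) η := by
  rw [expStarOmegaHom_apply, expStarOmega_oneCocycleClass]
  rfl

/-- **Class-level (RES_w) ⇒ the cocycle-level compatibility of (S5b-tower).**  If hLog₀'s hypothesis
`exp*_{dw} ∘ cohomologyRes = algebraMap ∘ exp*_d` holds on classes, then for every cocycle `η₀` over `ℚ_v` and every
cocycle `η` over `L` restricting it (`η = η₀ ∘ res` pointwise) one has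
`expStarCoordTower dw η = algebraMap (expStarCoord d η₀)` — the `compat` binder of
`exists_smul_range_expStarCoord_tower_iff_trace_log` and of w2-acc4's `dualInt_of_towerFact`.
[cite: Kato1993LNM1553, Ch. II §1.2.4] -/
theorem compat_of_res (d : LocalNeronLineAt W p v)
    (dw : LocalNeronLine W hL ((galRestrictPlace v).comp (absGaloisRestrict (Place.Completion (Sum.inr v : Place ℚ)) L)))
    (hinjw : (bdRPeriodRingData hL).CupLogInjective (logCyclotomic p)
      (localRationalTateRep W p ((galRestrictPlace v).comp (absGaloisRestrict (Place.Completion (Sum.inr v : Place ℚ)) L))))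
    (hexw : ∀ z : contOneCocycles (localRationalTateRep W p ((galRestrictPlace v).comp
        (absGaloisRestrict (Place.Completion (Sum.inr v : Place ℚ)) L))).toTopRep,
      (bdRPeriodRingData hL).HasDualExp (logCyclotomic p)
        (localRationalTateRep W p ((galRestrictPlace v).comp
          (absGaloisRestrict (Place.Completion (Sum.inr v : Place ℚ)) L))) fun σ => z.1 σ)
    (hresw : ∀ h : (tateLocalRep W p (Sum.inr v)).cohomology 1,
      expStarOmegaHom hL ((galRestrictPlace v).comp (absGaloisRestrict (Place.Completion (Sum.inr v : Place ℚ)) L))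
          dw hinjw hexw
        (ContinuousRep.cohomologyRes (tateLocalRep W p (Sum.inr v))
          (absGaloisRestrict (Place.Completion (Sum.inr v : Place ℚ)) L) 1 h) =
      algebraMap (Place.Completion (Sum.inr v : Place ℚ)) L (expStarOmegaAt d h))
    (η₀ : contOneCocycles (restrictedTateRep W (Place.Completion (Sum.inr v : Place ℚ)) p).toTopRep)
    (η : contOneCocycles ((restrictedTateRep W (Place.Completion (Sum.inr v : Place ℚ)) p).restrict
      (absGaloisRestrict (Place.Completion (Sum.inr v : Place ℚ)) L)).toTopRep)
    (hη : ∀ σ, η.1 σ = η₀.1 (absGaloisRestrict (Place.Completion (Sum.inr v : Place ℚ)) L σ)) :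
    expStarCoordTower W hL (show (bdRPeriodRingData hL).FilZeroLine
        ((restrictedRationalTateRep W (Place.Completion (Sum.inr v : Place ℚ)) p).restrict
          (absGaloisRestrict (Place.Completion (Sum.inr v : Place ℚ)) L)) from dw) η =
      algebraMap (Place.Completion (Sum.inr v : Place ℚ)) L (expStarCoord W (valuation_place_lt_one p v) d η₀) := by
  have h1 := hresw (oneCocycleClass _ η₀)
  rw [cohomologyRes_oneCocycleClass] at h1
  have hη' : contOneCocycles.pullback (absGaloisRestrict (Place.Completion (Sum.inr v : Place ℚ)) L)
      (Y := ((tateLocalRep W p (Sum.inr v)).restrict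
        (absGaloisRestrict (Place.Completion (Sum.inr v : Place ℚ)) L)).toTopRep)
      (TopRep.ofHom ⟨ContinuousLinearMap.id ℤ (W.tateModule p), fun _ => rfl⟩) η₀ = η := by
    apply Subtype.ext
    apply ContinuousMap.ext
    intro σ
    exact (hη σ).symm
  subst hη'
  rw [expStarOmegaHom_apply, expStarOmegaAt_eq_expStarCoord] at h1
  -- the same cocycle, typed over `localTateRep W p (r ∘ res)` (definitionally the restricted representation)
  let η' : contOneCocycles (localTateRep W p ((galRestrictPlace v).comp
      (absGaloisRestrict (Place.Completion (Sum.inr v : Place ℚ)) L))).toTopRep :=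
    contOneCocycles.pullback (absGaloisRestrict (Place.Completion (Sum.inr v : Place ℚ)) L)
      (Y := ((tateLocalRep W p (Sum.inr v)).restrict
        (absGaloisRestrict (Place.Completion (Sum.inr v : Place ℚ)) L)).toTopRep)
      (TopRep.ofHom ⟨ContinuousLinearMap.id ℤ (W.tateModule p), fun _ => rfl⟩) η₀
  have h2 := expStarOmega_oneCocycleClass hL ((galRestrictPlace v).comp
    (absGaloisRestrict (Place.Completion (Sum.inr v : Place ℚ)) L)) dw η'
  exact h2.symm.trans h1

end Summit.BirchSwinnertonDyer.BirchSwinnertonDyer.Theorems.KimAtThreeFineKatoHLog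

end
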